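import Summits.ResolutionOfSingularities.ResolutionOfSingularities.Theorems.EquisingularLiftCampaignW45bEquisingularLiftNat
import HarnessLib

/-!
# [OURS · L1 W4.5(b)] ULT — «USEFUL LIFT TOUCHES»: the necessary condition of EL♮ = `EquisingularLiftNat` at a non-regular,
# non-closed point of `H`, typed as the DISPROVER'S TARGET (statement-only typing + pure-logic anchors)

Everything here is OURS: campaign DEFINITIONS over the vocabulary of the EL♮ item `EquisingularLiftNat p`
(`Theorems/EquisingularLiftCampaignW45bEquisingularLiftNat.lean`, res-L1-type-o1 p482511 → v2 p484593; item text
`L/w45b/EL-NATURAL/sig-EquisingularLiftNat.importfree.txt` e7ca4a6668c5c33a, registered as stmt-ResolutionOfSingularities-20038)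
plus pure-logic anchors. Nothing here is a statement of Hironaka's manuscript (EL♮ replaces the role of NOTHING in the manuscript —
it is the W4.5(b) door); no `Literature.…` FACT is used. Typed by res-L1-type-o1 (OURS typer o1, gen 6, 2026-08-27) on
res-L1-w45b-plan-1's FILED WORDS 2026-08-27T04:50:33Z (`L/w45b/EL-NATURAL/ULT-L0COMP-WORDS.md` sha16 348d2c3672547fbc, §ULT and
§V) and ACK 04:53:58Z (d). Host: `--supports stmt-ResolutionOfSingularities-20038 --as helper`. ROUTE-INDEPENDENT module (imports
only the EL♮ statement file, which imports no `Theses/…` file).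

WHAT IS TYPED (the words' «Lean shape», rendered over the item text BYTE-FOR-BYTE except at the three marked places)
* `EquisingularLift.ULT p` — **ULT, with horizontality** (the words' ULT(H, x) universally quantified over the instances): the
  item text of `EquisingularLiftNat p` with (o) an extra universally quantified point `h : H` carrying «`𝒪_{H,h}` is not a
  regular local ring» and «`h` is not a closed point» right after the item's hypotheses on `(k, n, H, ι)` (binder (B) below);
  (i) the step clause of the closure predicate `Q` additionally recording AVOIDANCE «`x ∉ σ′ '' C.support`», `x :=` the image of
  `h` in `P = ℙⁿ_O` under `ι ≫ Proj.map φ`; (ii) the conclusion after the chain `(P′, σ, S′)` replaced by «there is an ideal sheaf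
  `C` on `P′` with `IsRegular C.subscheme`, a point `x′ ∈ C.support` over `x` FROM WHICH `C` IS HORIZONTAL (some `c ∈ C.support`
  outside the special fibre specialises to `x′`), E1 `C.support ∩ (σ ≫ q)⁻¹{s₀} ⊆ closure S′`, and non-dominance
  `σ '' C.support ⊆ {y | ¬ IsGenericPoint y Y}`» — the hypotheses the item imposes on a STEP's centre, now asked of a centre
  THROUGH `x′` after a chain AVOIDING `x`.
* `EquisingularLift.ULTWeak p` — the same WITHOUT the horizontality conjunct (the words allow omitting it: «the necessary-condition
  proof gives it via V, and a disprover refuting the weaker typed ULT refutes more»). TYPER'S VACUITY FINDING (below): `ULTWeak`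
  is TRIVIALLY TRUE at every instance whose curve `Σ = closure {x}` is regular as a reduced scheme (take the EMPTY chain and the
  VERTICAL centre `C := 𝓘_Σ`), so `ULTWeak` is the target of the FIRST-TOUCH implication `EquisingularLiftNat p → ULTWeak p` only,
  while `ULT` (horizontal) is the disprover's meaningful target; `EquisingularLiftNat p → ULT p` needs lemma V (no vertical
  centres) in addition. Both implications are PROOF content (w45b provers), not typed here.
* `EquisingularLift.ULTAt p k n H ι h` / `ULTWeakAt …` — the per-instance bodies (everything from `∃ O` on), so that the
  disprover's deliverable is literally `¬ ULTAt p k n H ι h` at ONE instance; anchors `ult_iff` / `ultWeak_iff` (`Iff.rfl`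
  factorisations), `ultWeak_of_ult`, `ultWeakAt_of_ultAt`, `not_ult_of_not_ultAt`, `not_equisingularLiftNat_of_not_ult`
  (the K-LSE-0 (iii) shape: ONE instance with `¬ ULTAt`, GIVEN the implication `EquisingularLiftNat p → ULT p`, refutes the item).
* `EquisingularLift.SpecialFibreReduciblePersists n` — lemma V's «one-line engine» as a typed Prop (res-L1-w45b-plan-1 ACK (d):
  «include lemma V's persistence half if cheap»): along a blow-up `τ : X″ → X′` of an INTEGRAL `X′` over `P = ℙⁿ_O`, a reducible
  (or empty) special fibre stays reducible (or empty). Typed only; its proof (blow-ups of integral schemes along nonzero ideals are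
  surjective; preimages of reducible closed sets under closed surjections are reducible; the zero ideal blows up to `∅`) is PROVER
  content. The other half of V («a vertical centre of codimension ≥ 2 makes the next special fibre reducible») stays words.

BINDER (B) for the point (the words: «x = the generic point of a 1-dimensional component Σ of the non-regular locus of H; any
faithful rendering will do, the disprover needs only ONE instance»): typed on the `H` side as `h : H` with
`¬ IsRegularLocalRing (H.presheaf.stalk h)` and `¬ IsClosed {h}`. For `n = 3` (H an integral surface) these are EXACTLY the generic
points of the 1-dimensional components of the non-regular locus (a non-closed point of a surface other than `η_H` is the generic
point of a curve, `𝒪_{H,η_H}` is a field hence regular, and the non-regular locus has dimension ≤ 1); for `n ≥ 4` the typed class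
is a SUPERSET (generic points of higher-dimensional components, or of non-component curves inside the non-regular locus) — every
such point still satisfies the first-touch argument, so the implication from the item is unaffected and the disprover's `n = 3`
instances are literally the words' instances. `x ≠ η_H` and `x ∈ Y` need no clause (regularity of the generic stalk; `Y = range`).

VACUITY / STRENGTH SELF-CHECK (typer). `ULT p`: NOT trivially true — at an instance `(H, h)` it asks for a regular centre through the
point over `x`, horizontal there, with E1 and non-dominance, after an avoiding chain; with the EMPTY chain a horizontal regular `C`
through `x` with `C ∩ ℙⁿ_k ⊆ H` is a regular `O`-curve or `O`-surface in `ℙⁿ_O` specialising into `H` through `Σ` — a LIFTING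
statement (cf. the words' LIFT(Σ) / PUSHDOWN), not available for free; NOT trivially false — implied by the item via first touch +
V (words §ULT «Claim», 8 lines by hand; to be kernel-checked by a w45b prover). `ULTWeak p`: trivially TRUE at instances with
`Σ_red` regular (vertical witness `C = 𝓘_Σ`: regular, through `x`, inside the special fibre so E1 reads `Σ ⊆ Y` ✓, non-dominant
since `x ≠ η_Y` ✓) — DISCLOSED; it is kept only as the target of the V-free implication. `SpecialFibreReduciblePersists n`:
contentful (false without `IsIntegral X′`: a centre swallowing a whole component of a reducible `X′`), classical, expected TRUE.
The hypotheses of all three are satisfiable (singular integral hypersurfaces with a singular curve exist in every `ℙ³_k`).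

AI-WRITTEN; NO expert review; AI review is weaker than expert review. Nothing here is attributed to any manuscript. References:
L/w45b/EL-NATURAL/ULT-L0COMP-WORDS.md (348d2c3672547fbc), L/w45b/CRUX-PLAN v3.0.1 §1.3/§1.6, L/w45b/CHAIN.md v6.1 (7f97ee27634c7ad3)
— OURS planning texts, index only; R. Hartshorne, *Deformation Theory* Rem. 22.3.1 / Prop. 29.9; R. Vakil, Murphy's law
[arXiv:math/0411469] — context of the words' LIFT/L0-COMP paragraphs only, not used.
-/

noncomputable section

set_option linter.dupNamespace false -- mandated namespace of this single-conjunct summit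

namespace Summit.ResolutionOfSingularities.ResolutionOfSingularities.Theorems

namespace EquisingularLift

/-! ## §1 The per-instance bodies -/

/-- [OURS · L1 W4.5(b)] replaces the role of NOTHING in the manuscript (EL♮ door); NOT a statement of the manuscript. **ULT AT ONE
INSTANCE `(k, n, H, ι, h)`, WITH HORIZONTALITY** — the words' ULT(H, x) for `x :=` the image of `h`: there are a characteristic-0 DVR
`O` with a surjection `π : O → k` such that for every graded `φ` inducing `MvPolynomial.map π` and `Y = range (ι ≫ Proj.map φ)`
there are `(P′, σ, S′)` in the inductive closure of `(P, 𝟙, Y)` under E1-steps WHOSE CENTRES AVOID `x` (clause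
`x ∉ σ′ '' C.support`), and an ideal sheaf `C` on `P′`: `C.subscheme` regular; some `x′ ∈ C.support` with `σ x′ = x` and some
`c ∈ C.support` OUTSIDE the special fibre with `c ⤳ x′` (horizontal at `x′`); `C.support ∩ (σ ≫ q)⁻¹{s₀} ⊆ closure S′` (E1);
`σ '' C.support ⊆ {y | ¬ IsGenericPoint y Y}` (non-dominant). The disprover's deliverable is `¬ ULTAt p k n H ι h` at ONE
instance satisfying binder (B). VACUITY: module docstring. [folklore] -/
def ULTAt (p : ℕ) (k : Type) [Field k] [CharP k p] [IsAlgClosed k] (n : ℕ) (H : AlgebraicGeometry.Scheme.{0})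
    (ι : H ⟶ (Literature.AlgebraicGeometry.Motives.projectiveSpace n k).left) (h : H) : Prop :=
  ∃ (O : Type) (_ : CommRing O) (_ : IsDomain O) (_ : IsDiscreteValuationRing O) (_ : CharZero O) (π : O →+* k), Function.Surjective π ∧ (letI := MvPolynomial.gradedAlgebra (σ := Fin (n + 1)) (R := O); letI := MvPolynomial.gradedAlgebra (σ := Fin (n + 1)) (R := k); ∀ (φ : MvPolynomial.homogeneousSubmodule (Fin (n + 1)) O →+*ᵍ MvPolynomial.homogeneousSubmodule (Fin (n + 1)) k) (hφ' : HomogeneousIdeal.irrelevant (MvPolynomial.homogeneousSubmodule (Fin (n + 1)) k) ≤ (HomogeneousIdeal.irrelevant (MvPolynomial.homogeneousSubmodule (Fin (n + 1)) O)).map φ), (∀ s, φ s = MvPolynomial.map π s) → ∀ Y : Set (AlgebraicGeometry.Proj (MvPolynomial.homogeneousSubmodule (Fin (n + 1)) O)), Y = Set.range (CategoryTheory.CategoryStruct.comp ι (AlgebraicGeometry.Proj.map φ hφ') : H ⟶ (AlgebraicGeometry.Proj (MvPolynomial.homogeneousSubmodule (Fin (n + 1)) O))) → ∃ (P' : AlgebraicGeometry.Scheme.{0})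 (σ : P' ⟶ (AlgebraicGeometry.Proj (MvPolynomial.homogeneousSubmodule (Fin (n + 1)) O))) (S' : Set P'), (∀ Q : (∀ X' : AlgebraicGeometry.Scheme.{0}, (X' ⟶ (AlgebraicGeometry.Proj (MvPolynomial.homogeneousSubmodule (Fin (n + 1)) O))) → Set X' → Prop), Q (AlgebraicGeometry.Proj (MvPolynomial.homogeneousSubmodule (Fin (n + 1)) O)) (CategoryTheory.CategoryStruct.id _) Y → (∀ (X' X'' : AlgebraicGeometry.Scheme.{0}) (σ' : X' ⟶ (AlgebraicGeometry.Proj (MvPolynomial.homogeneousSubmodule (Fin (n + 1)) O))) (Y' : Set X') (C : X'.IdealSheafData) (τ : X'' ⟶ X'), Q X' σ' Y' → Literature.AlgebraicGeometry.Resolution.IsBlowup τ C → Literature.AlgebraicGeometry.Resolution.Scheme.IsRegular C.subscheme → σ' '' (C.support : Set X') ⊆ {x | ¬ IsGenericPoint x Y} → (C.support : Set X') ∩ (CategoryTheory.CategoryStruct.comp σ' (CategoryTheory.CategoryStruct.comp (AlgebraicGeometry.Proj.toSpecZero (MvPolynomial.homogeneousSubmodule (Fin (n + 1)) O)) (AlgebraicGeometry.Spec.map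 (CommRingCat.ofHom (algebraMap O (MvPolynomial.homogeneousSubmodule (Fin (n + 1)) O 0)))))) ⁻¹' {IsLocalRing.closedPoint O} ⊆ Y' → ((CategoryTheory.CategoryStruct.comp ι (AlgebraicGeometry.Proj.map φ hφ') : H ⟶ (AlgebraicGeometry.Proj (MvPolynomial.homogeneousSubmodule (Fin (n + 1)) O))) h) ∉ σ' '' (C.support : Set X') → Q X'' (CategoryTheory.CategoryStruct.comp τ σ') (closure (τ ⁻¹' (Y' \ (C.support : Set X'))))) → Q P' σ S') ∧ ∃ C : P'.IdealSheafData, Literature.AlgebraicGeometry.Resolution.Scheme.IsRegular C.subscheme ∧ (∃ x' : P', x' ∈ (C.support : Set P') ∧ σ x' = ((CategoryTheory.CategoryStruct.comp ι (AlgebraicGeometry.Proj.map φ hφ') : H ⟶ (AlgebraicGeometry.Proj (MvPolynomial.homogeneousSubmodule (Fin (n + 1)) O))) h) ∧ ∃ c : P', c ∈ (C.support : Set P') ∧ c ∉ (CategoryTheory.CategoryStruct.comp σ (CategoryTheory.CategoryStruct.comp (AlgebraicGeometry.Proj.toSpecZero (MvPolynomial.homogeneousSubmodule (Fin (n + 1))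 O)) (AlgebraicGeometry.Spec.map (CommRingCat.ofHom (algebraMap O (MvPolynomial.homogeneousSubmodule (Fin (n + 1)) O 0)))))) ⁻¹' {IsLocalRing.closedPoint O} ∧ c ⤳ x') ∧ (C.support : Set P') ∩ (CategoryTheory.CategoryStruct.comp σ (CategoryTheory.CategoryStruct.comp (AlgebraicGeometry.Proj.toSpecZero (MvPolynomial.homogeneousSubmodule (Fin (n + 1)) O)) (AlgebraicGeometry.Spec.map (CommRingCat.ofHom (algebraMap O (MvPolynomial.homogeneousSubmodule (Fin (n + 1)) O 0)))))) ⁻¹' {IsLocalRing.closedPoint O} ⊆ closure S' ∧ σ '' (C.support : Set P') ⊆ {x | ¬ IsGenericPoint x Y})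

/-- [OURS · L1 W4.5(b)] replaces the role of NOTHING in the manuscript; NOT a statement of the manuscript. **ULT AT ONE INSTANCE,
WITHOUT HORIZONTALITY** (`ULTAt` minus the clause `∃ c ∈ C.support, c ∉ special fibre ∧ c ⤳ x′`). DISCLOSED VACUITY: trivially
true when `closure {x}` is regular as a reduced curve (empty chain, vertical centre `𝓘_Σ`); kept as the target of the V-free
first-touch implication only. [folklore] -/
def ULTWeakAt (p : ℕ) (k : Type) [Field k] [CharP k p] [IsAlgClosed k] (n : ℕ) (H : AlgebraicGeometry.Scheme.{0})
    (ι : H ⟶ (Literature.AlgebraicGeometry.Motives.projectiveSpace n k).left) (h : H) : Prop :=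
  ∃ (O : Type) (_ : CommRing O) (_ : IsDomain O) (_ : IsDiscreteValuationRing O) (_ : CharZero O) (π : O →+* k), Function.Surjective π ∧ (letI := MvPolynomial.gradedAlgebra (σ := Fin (n + 1)) (R := O); letI := MvPolynomial.gradedAlgebra (σ := Fin (n + 1)) (R := k); ∀ (φ : MvPolynomial.homogeneousSubmodule (Fin (n + 1)) O →+*ᵍ MvPolynomial.homogeneousSubmodule (Fin (n + 1)) k) (hφ' : HomogeneousIdeal.irrelevant (MvPolynomial.homogeneousSubmodule (Fin (n + 1)) k) ≤ (HomogeneousIdeal.irrelevant (MvPolynomial.homogeneousSubmodule (Fin (n + 1)) O)).map φ), (∀ s, φ s = MvPolynomial.map π s) → ∀ Y : Set (AlgebraicGeometry.Proj (MvPolynomial.homogeneousSubmodule (Fin (n + 1)) O)), Y = Set.range (CategoryTheory.CategoryStruct.comp ι (AlgebraicGeometry.Proj.map φ hφ') : H ⟶ (AlgebraicGeometry.Proj (MvPolynomial.homogeneousSubmodule (Fin (n + 1)) O))) → ∃ (P' : AlgebraicGeometry.Scheme.{0}) (σ : P' ⟶ (AlgebraicGeometry.Proj (MvPolynomial.homogeneousSubmodule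 (Fin (n + 1)) O))) (S' : Set P'), (∀ Q : (∀ X' : AlgebraicGeometry.Scheme.{0}, (X' ⟶ (AlgebraicGeometry.Proj (MvPolynomial.homogeneousSubmodule (Fin (n + 1)) O))) → Set X' → Prop), Q (AlgebraicGeometry.Proj (MvPolynomial.homogeneousSubmodule (Fin (n + 1)) O)) (CategoryTheory.CategoryStruct.id _) Y → (∀ (X' X'' : AlgebraicGeometry.Scheme.{0}) (σ' : X' ⟶ (AlgebraicGeometry.Proj (MvPolynomial.homogeneousSubmodule (Fin (n + 1)) O))) (Y' : Set X') (C : X'.IdealSheafData) (τ : X'' ⟶ X'), Q X' σ' Y' → Literature.AlgebraicGeometry.Resolution.IsBlowup τ C → Literature.AlgebraicGeometry.Resolution.Scheme.IsRegular C.subscheme → σ' '' (C.support : Set X') ⊆ {x | ¬ IsGenericPoint x Y} → (C.support : Set X') ∩ (CategoryTheory.CategoryStruct.comp σ' (CategoryTheory.CategoryStruct.comp (AlgebraicGeometry.Proj.toSpecZero (MvPolynomial.homogeneousSubmodule (Fin (n + 1)) O)) (AlgebraicGeometry.Spec.map (CommRingCat.ofHom (algebraMap O (MvPolynomial.homogeneousSubmodule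 (Fin (n + 1)) O 0)))))) ⁻¹' {IsLocalRing.closedPoint O} ⊆ Y' → ((CategoryTheory.CategoryStruct.comp ι (AlgebraicGeometry.Proj.map φ hφ') : H ⟶ (AlgebraicGeometry.Proj (MvPolynomial.homogeneousSubmodule (Fin (n + 1)) O))) h) ∉ σ' '' (C.support : Set X') → Q X'' (CategoryTheory.CategoryStruct.comp τ σ') (closure (τ ⁻¹' (Y' \ (C.support : Set X'))))) → Q P' σ S') ∧ ∃ C : P'.IdealSheafData, Literature.AlgebraicGeometry.Resolution.Scheme.IsRegular C.subscheme ∧ (∃ x' : P', x' ∈ (C.support : Set P') ∧ σ x' = ((CategoryTheory.CategoryStruct.comp ι (AlgebraicGeometry.Proj.map φ hφ') : H ⟶ (AlgebraicGeometry.Proj (MvPolynomial.homogeneousSubmodule (Fin (n + 1)) O))) h)) ∧ (C.support : Set P') ∩ (CategoryTheory.CategoryStruct.comp σ (CategoryTheory.CategoryStruct.comp (AlgebraicGeometry.Proj.toSpecZero (MvPolynomial.homogeneousSubmodule (Fin (n + 1)) O)) (AlgebraicGeometry.Spec.map (CommRingCat.ofHom (algebraMap O (MvPolynomial.homogeneousSubmodule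 (Fin (n + 1)) O 0)))))) ⁻¹' {IsLocalRing.closedPoint O} ⊆ closure S' ∧ σ '' (C.support : Set P') ⊆ {x | ¬ IsGenericPoint x Y})

/-! ## §2 ULT and ULTWeak (the item text with the marked modifications) -/

/-- [OURS · L1 W4.5(b)] replaces the role of NOTHING in the manuscript (EL♮ door, W4.5(b)); NOT a statement of the manuscript.
**ULT — «USEFUL LIFT TOUCHES», the NECESSARY CONDITION of `EquisingularLiftNat p` (given lemma V), typed as the disprover's
target**: for prime `p`, every algebraically closed `k` of characteristic `p`, every `n`, every integral closed `H ⊆ ℙⁿ_k` with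
locally principal ideal (the item's binders, verbatim) AND every point `h` of `H` whose local ring is not regular and which is not
closed (binder (B)): `ULTAt p k n H ι h`. Text = the item text e7ca4a6668c5c33a with modifications (o) (i) (ii) of the module
docstring and NOTHING else (`ult_iff`). ONE instance with `¬ ULTAt …` refutes the item GIVEN `EquisingularLiftNat p → ULT p`
(`not_equisingularLiftNat_of_not_ult`; the implication = first touch + V, prover content). [folklore] -/
def ULT (p : ℕ) : Prop :=
  p.Prime → ∀ (k : Type) [Field k] [CharP k p] [IsAlgClosed k] (n : ℕ) (H : AlgebraicGeometry.Scheme.{0}) (ι : H ⟶ (Literature.AlgebraicGeometry.Motives.projectiveSpace n k).left), AlgebraicGeometry.IsClosedImmersion ι → AlgebraicGeometry.IsIntegral H → (∀ y : (Literature.AlgebraicGeometry.Motives.projectiveSpace n k).left, ∃ U : (Literature.AlgebraicGeometry.Motives.projectiveSpace n k).left.affineOpens, y ∈ (U : (Literature.AlgebraicGeometry.Motives.projectiveSpace n k).left.Opens) ∧ (ι.ker.ideal U).IsPrincipal) → ∀ (h : H), ¬ IsRegularLocalRing (H.presheaf.stalk h) → ¬ IsClosed ({h} : Set H) → ∃ (O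 : Type) (_ : CommRing O) (_ : IsDomain O) (_ : IsDiscreteValuationRing O) (_ : CharZero O) (π : O →+* k), Function.Surjective π ∧ (letI := MvPolynomial.gradedAlgebra (σ := Fin (n + 1)) (R := O); letI := MvPolynomial.gradedAlgebra (σ := Fin (n + 1)) (R := k); ∀ (φ : MvPolynomial.homogeneousSubmodule (Fin (n + 1)) O →+*ᵍ MvPolynomial.homogeneousSubmodule (Fin (n + 1)) k) (hφ' : HomogeneousIdeal.irrelevant (MvPolynomial.homogeneousSubmodule (Fin (n + 1)) k) ≤ (HomogeneousIdeal.irrelevant (MvPolynomial.homogeneousSubmodule (Fin (n + 1)) O)).map φ), (∀ s, φ s = MvPolynomial.map π s) → ∀ Y : Set (AlgebraicGeometry.Proj (MvPolynomial.homogeneousSubmodule (Fin (n + 1)) O)), Y = Set.range (CategoryTheory.CategoryStruct.comp ι (AlgebraicGeometry.Proj.map φ hφ') : H ⟶ (AlgebraicGeometry.Proj (MvPolynomial.homogeneousSubmodule (Fin (n + 1)) O))) → ∃ (P' : AlgebraicGeometry.Scheme.{0}) (σ : P' ⟶ (AlgebraicGeometry.Proj (MvPolynomial.homogeneousSubmodule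 (Fin (n + 1)) O))) (S' : Set P'), (∀ Q : (∀ X' : AlgebraicGeometry.Scheme.{0}, (X' ⟶ (AlgebraicGeometry.Proj (MvPolynomial.homogeneousSubmodule (Fin (n + 1)) O))) → Set X' → Prop), Q (AlgebraicGeometry.Proj (MvPolynomial.homogeneousSubmodule (Fin (n + 1)) O)) (CategoryTheory.CategoryStruct.id _) Y → (∀ (X' X'' : AlgebraicGeometry.Scheme.{0}) (σ' : X' ⟶ (AlgebraicGeometry.Proj (MvPolynomial.homogeneousSubmodule (Fin (n + 1)) O))) (Y' : Set X') (C : X'.IdealSheafData) (τ : X'' ⟶ X'), Q X' σ' Y' → Literature.AlgebraicGeometry.Resolution.IsBlowup τ C → Literature.AlgebraicGeometry.Resolution.Scheme.IsRegular C.subscheme → σ' '' (C.support : Set X') ⊆ {x | ¬ IsGenericPoint x Y} → (C.support : Set X') ∩ (CategoryTheory.CategoryStruct.comp σ' (CategoryTheory.CategoryStruct.comp (AlgebraicGeometry.Proj.toSpecZero (MvPolynomial.homogeneousSubmodule (Fin (n + 1)) O)) (AlgebraicGeometry.Spec.map (CommRingCat.ofHom (algebraMap O (MvPolynomial.homogeneousSubmodule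 (Fin (n + 1)) O 0)))))) ⁻¹' {IsLocalRing.closedPoint O} ⊆ Y' → ((CategoryTheory.CategoryStruct.comp ι (AlgebraicGeometry.Proj.map φ hφ') : H ⟶ (AlgebraicGeometry.Proj (MvPolynomial.homogeneousSubmodule (Fin (n + 1)) O))) h) ∉ σ' '' (C.support : Set X') → Q X'' (CategoryTheory.CategoryStruct.comp τ σ') (closure (τ ⁻¹' (Y' \ (C.support : Set X'))))) → Q P' σ S') ∧ ∃ C : P'.IdealSheafData, Literature.AlgebraicGeometry.Resolution.Scheme.IsRegular C.subscheme ∧ (∃ x' : P', x' ∈ (C.support : Set P') ∧ σ x' = ((CategoryTheory.CategoryStruct.comp ι (AlgebraicGeometry.Proj.map φ hφ') : H ⟶ (AlgebraicGeometry.Proj (MvPolynomial.homogeneousSubmodule (Fin (n + 1)) O))) h) ∧ ∃ c : P', c ∈ (C.support : Set P') ∧ c ∉ (CategoryTheory.CategoryStruct.comp σ (CategoryTheory.CategoryStruct.comp (AlgebraicGeometry.Proj.toSpecZero (MvPolynomial.homogeneousSubmodule (Fin (n + 1)) O)) (AlgebraicGeometry.Spec.map (CommRingCat.ofHom (algebraMap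 O (MvPolynomial.homogeneousSubmodule (Fin (n + 1)) O 0)))))) ⁻¹' {IsLocalRing.closedPoint O} ∧ c ⤳ x') ∧ (C.support : Set P') ∩ (CategoryTheory.CategoryStruct.comp σ (CategoryTheory.CategoryStruct.comp (AlgebraicGeometry.Proj.toSpecZero (MvPolynomial.homogeneousSubmodule (Fin (n + 1)) O)) (AlgebraicGeometry.Spec.map (CommRingCat.ofHom (algebraMap O (MvPolynomial.homogeneousSubmodule (Fin (n + 1)) O 0)))))) ⁻¹' {IsLocalRing.closedPoint O} ⊆ closure S' ∧ σ '' (C.support : Set P') ⊆ {x | ¬ IsGenericPoint x Y})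

/-- [OURS · L1 W4.5(b)] replaces the role of NOTHING in the manuscript; NOT a statement of the manuscript. **ULTWeak — ULT without
horizontality**: binders as `ULT`, conclusion `ULTWeakAt`. The target of the V-FREE first-touch implication
`EquisingularLiftNat p → ULTWeak p` (prover content: a step whose centre avoids `x` leaves `𝒪_{H,x}` unchanged, the end is regular,
so some first step touches `x′`). DISCLOSED VACUITY as for `ULTWeakAt`. [folklore] -/
def ULTWeak (p : ℕ) : Prop :=
  p.Prime → ∀ (k : Type) [Field k] [CharP k p] [IsAlgClosed k] (n : ℕ) (H : AlgebraicGeometry.Scheme.{0}) (ι : H ⟶ (Literature.AlgebraicGeometry.Motives.projectiveSpace n k).left), AlgebraicGeometry.IsClosedImmersion ι → AlgebraicGeometry.IsIntegral H → (∀ y : (Literature.AlgebraicGeometry.Motives.projectiveSpace n k).left, ∃ U : (Literature.AlgebraicGeometry.Motives.projectiveSpace n k).left.affineOpens, y ∈ (U : (Literature.AlgebraicGeometry.Motives.projectiveSpace n k).left.Opens) ∧ (ι.ker.ideal U).IsPrincipal) → ∀ (h : H), ¬ IsRegularLocalRing (H.presheaf.stalk h) → ¬ IsClosed ({h} : Set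 H) → ∃ (O : Type) (_ : CommRing O) (_ : IsDomain O) (_ : IsDiscreteValuationRing O) (_ : CharZero O) (π : O →+* k), Function.Surjective π ∧ (letI := MvPolynomial.gradedAlgebra (σ := Fin (n + 1)) (R := O); letI := MvPolynomial.gradedAlgebra (σ := Fin (n + 1)) (R := k); ∀ (φ : MvPolynomial.homogeneousSubmodule (Fin (n + 1)) O →+*ᵍ MvPolynomial.homogeneousSubmodule (Fin (n + 1)) k) (hφ' : HomogeneousIdeal.irrelevant (MvPolynomial.homogeneousSubmodule (Fin (n + 1)) k) ≤ (HomogeneousIdeal.irrelevant (MvPolynomial.homogeneousSubmodule (Fin (n + 1)) O)).map φ), (∀ s, φ s = MvPolynomial.map π s) → ∀ Y : Set (AlgebraicGeometry.Proj (MvPolynomial.homogeneousSubmodule (Fin (n + 1)) O)), Y = Set.range (CategoryTheory.CategoryStruct.comp ι (AlgebraicGeometry.Proj.map φ hφ') : H ⟶ (AlgebraicGeometry.Proj (MvPolynomial.homogeneousSubmodule (Fin (n + 1)) O))) → ∃ (P' : AlgebraicGeometry.Scheme.{0}) (σ : P' ⟶ (AlgebraicGeometry.Proj (MvPolynomial.homogeneousSubmodule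 (Fin (n + 1)) O))) (S' : Set P'), (∀ Q : (∀ X' : AlgebraicGeometry.Scheme.{0}, (X' ⟶ (AlgebraicGeometry.Proj (MvPolynomial.homogeneousSubmodule (Fin (n + 1)) O))) → Set X' → Prop), Q (AlgebraicGeometry.Proj (MvPolynomial.homogeneousSubmodule (Fin (n + 1)) O)) (CategoryTheory.CategoryStruct.id _) Y → (∀ (X' X'' : AlgebraicGeometry.Scheme.{0}) (σ' : X' ⟶ (AlgebraicGeometry.Proj (MvPolynomial.homogeneousSubmodule (Fin (n + 1)) O))) (Y' : Set X') (C : X'.IdealSheafData) (τ : X'' ⟶ X'), Q X' σ' Y' → Literature.AlgebraicGeometry.Resolution.IsBlowup τ C → Literature.AlgebraicGeometry.Resolution.Scheme.IsRegular C.subscheme → σ' '' (C.support : Set X') ⊆ {x | ¬ IsGenericPoint x Y} → (C.support : Set X') ∩ (CategoryTheory.CategoryStruct.comp σ' (CategoryTheory.CategoryStruct.comp (AlgebraicGeometry.Proj.toSpecZero (MvPolynomial.homogeneousSubmodule (Fin (n + 1)) O)) (AlgebraicGeometry.Spec.map (CommRingCat.ofHom (algebraMap O (MvPolynomial.homogeneousSubmodule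 (Fin (n + 1)) O 0)))))) ⁻¹' {IsLocalRing.closedPoint O} ⊆ Y' → ((CategoryTheory.CategoryStruct.comp ι (AlgebraicGeometry.Proj.map φ hφ') : H ⟶ (AlgebraicGeometry.Proj (MvPolynomial.homogeneousSubmodule (Fin (n + 1)) O))) h) ∉ σ' '' (C.support : Set X') → Q X'' (CategoryTheory.CategoryStruct.comp τ σ') (closure (τ ⁻¹' (Y' \ (C.support : Set X'))))) → Q P' σ S') ∧ ∃ C : P'.IdealSheafData, Literature.AlgebraicGeometry.Resolution.Scheme.IsRegular C.subscheme ∧ (∃ x' : P', x' ∈ (C.support : Set P') ∧ σ x' = ((CategoryTheory.CategoryStruct.comp ι (AlgebraicGeometry.Proj.map φ hφ') : H ⟶ (AlgebraicGeometry.Proj (MvPolynomial.homogeneousSubmodule (Fin (n + 1)) O))) h)) ∧ (C.support : Set P') ∩ (CategoryTheory.CategoryStruct.comp σ (CategoryTheory.CategoryStruct.comp (AlgebraicGeometry.Proj.toSpecZero (MvPolynomial.homogeneousSubmodule (Fin (n + 1)) O)) (AlgebraicGeometry.Spec.map (CommRingCat.ofHom (algebraMap O (MvPolynomial.homogeneousSubmodule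 (Fin (n + 1)) O 0)))))) ⁻¹' {IsLocalRing.closedPoint O} ⊆ closure S' ∧ σ '' (C.support : Set P') ⊆ {x | ¬ IsGenericPoint x Y})

/-! ## §3 Pure logic -/

/-- Pure logic: `ULT p` is binder (B) in front of `ULTAt`. [folklore] -/
theorem ult_iff (p : ℕ) :
    ULT p ↔ (p.Prime → ∀ (k : Type) [Field k] [CharP k p] [IsAlgClosed k] (n : ℕ) (H : AlgebraicGeometry.Scheme.{0}) (ι : H ⟶ (Literature.AlgebraicGeometry.Motives.projectiveSpace n k).left), AlgebraicGeometry.IsClosedImmersion ι → AlgebraicGeometry.IsIntegral H → (∀ y : (Literature.AlgebraicGeometry.Motives.projectiveSpace n k).left, ∃ U : (Literature.AlgebraicGeometry.Motives.projectiveSpace n k).left.affineOpens, y ∈ (U : (Literature.AlgebraicGeometry.Motives.projectiveSpace n k).left.Opens) ∧ (ι.ker.ideal U).IsPrincipal) → ∀ (h : H), ¬ IsRegularLocalRing (H.presheaf.stalk h) → ¬ IsClosed ({h} : Set H) → ULTAt p k n H ι h) :=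
  Iff.rfl

/-- Pure logic: `ULTWeak p` is binder (B) in front of `ULTWeakAt`. [folklore] -/
theorem ultWeak_iff (p : ℕ) :
    ULTWeak p ↔ (p.Prime → ∀ (k : Type) [Field k] [CharP k p] [IsAlgClosed k] (n : ℕ) (H : AlgebraicGeometry.Scheme.{0}) (ι : H ⟶ (Literature.AlgebraicGeometry.Motives.projectiveSpace n k).left), AlgebraicGeometry.IsClosedImmersion ι → AlgebraicGeometry.IsIntegral H → (∀ y : (Literature.AlgebraicGeometry.Motives.projectiveSpace n k).left, ∃ U : (Literature.AlgebraicGeometry.Motives.projectiveSpace n k).left.affineOpens, y ∈ (U : (Literature.AlgebraicGeometry.Motives.projectiveSpace n k).left.Opens) ∧ (ι.ker.ideal U).IsPrincipal) → ∀ (h : H), ¬ IsRegularLocalRing (H.presheaf.stalk h) → ¬ IsClosed ({h} : Set H) → ULTWeakAt p k n H ι h) :=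
  Iff.rfl

/-- Pure logic: horizontality may be forgotten, instance-wise. [folklore] -/
theorem ultWeakAt_of_ultAt {p : ℕ} {k : Type} [Field k] [CharP k p] [IsAlgClosed k] {n : ℕ} {H : AlgebraicGeometry.Scheme.{0}}
    {ι : H ⟶ (Literature.AlgebraicGeometry.Motives.projectiveSpace n k).left} {h : H} (hU : ULTAt p k n H ι h) :
    ULTWeakAt p k n H ι h := by
  obtain ⟨O, i1, i2, i3, i4, π, hπ, h'⟩ := hU
  refine ⟨O, i1, i2, i3, i4, π, hπ, ?_⟩
  intro φ hφ' hφ Y hY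
  obtain ⟨P', σ, S', hchain, C, hCreg, ⟨x', hx'C, hx', _⟩, hE1, hgen⟩ := h' φ hφ' hφ Y hY
  exact ⟨P', σ, S', hchain, C, hCreg, ⟨x', hx'C, hx'⟩, hE1, hgen⟩

/-- Pure logic: `ULT p → ULTWeak p`. [folklore] -/
theorem ultWeak_of_ult {p : ℕ} (hU : ULT p) : ULTWeak p :=
  fun hp k _ _ _ n H ι hι hH hloc h h1 h2 => ultWeakAt_of_ultAt (hU hp k n H ι hι hH hloc h h1 h2)

/-- Pure logic (the disprover's exit): ONE instance satisfying binder (B) with `¬ ULTAt` refutes `ULT p`. [folklore] -/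
theorem not_ult_of_not_ultAt {p : ℕ} (hp : p.Prime) {k : Type} [Field k] [CharP k p] [IsAlgClosed k] {n : ℕ}
    {H : AlgebraicGeometry.Scheme.{0}} {ι : H ⟶ (Literature.AlgebraicGeometry.Motives.projectiveSpace n k).left}
    (hι : AlgebraicGeometry.IsClosedImmersion ι) (hH : AlgebraicGeometry.IsIntegral H)
    (hloc : ∀ y : (Literature.AlgebraicGeometry.Motives.projectiveSpace n k).left,
      ∃ U : (Literature.AlgebraicGeometry.Motives.projectiveSpace n k).left.affineOpens,
        y ∈ (U : (Literature.AlgebraicGeometry.Motives.projectiveSpace n k).left.Opens) ∧ (ι.ker.ideal U).IsPrincipal)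
    {h : H} (h1 : ¬ IsRegularLocalRing (H.presheaf.stalk h)) (h2 : ¬ IsClosed ({h} : Set H))
    (hno : ¬ ULTAt p k n H ι h) : ¬ ULT p :=
  fun hU => hno (hU hp k n H ι hι hH hloc h h1 h2)

/-- Pure logic (K-LSE-0 (iii) shape): GIVEN the necessary-condition implication `EquisingularLiftNat p → ULT p` (first touch + V,
prover content), a refutation of `ULT p` refutes the item at `p`. [folklore] -/
theorem not_equisingularLiftNat_of_not_ult {p : ℕ} (himp : EquisingularLiftNat p → ULT p) (hno : ¬ ULT p) :
    ¬ EquisingularLiftNat p :=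
  fun hE => hno (himp hE)

/-! ## §4 Lemma V, persistence half (typed only) -/

/-- [OURS · L1 W4.5(b)] replaces the role of NOTHING in the manuscript; NOT a statement of the manuscript. **LEMMA V, PERSISTENCE
HALF — «irreducible components of the special fibre only grow in number under blow-ups»**, typed for the ambient `P = ℙⁿ_O` of the
item: for every DVR `O` (as in the item), all `X′ X″` over `P` with `X′` INTEGRAL, every ideal sheaf `C` on `X′` and every blow-up
`τ : X″ → X′` along `C`: if the special fibre `(σ′ ≫ q)⁻¹{s₀}` of `X′` is not irreducible (reducible or empty), then neither is the
special fibre `(τ ≫ σ′ ≫ q)⁻¹{s₀}` of `X″`. (No regularity of `C` needed; `C = 0` blows up to `∅`.) Proof = prover content; the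
words' other half of V (a VERTICAL centre of codimension ≥ 2 CREATES a second component) is not typed here. VACUITY: false without
`IsIntegral X′`; hypotheses satisfiable. **ERRATUM (v2, 2026-08-27T05:30Z): REFUTED-AS-TYPED BY HAND** (res-D-pv-002 05:23:58Z, AI hand
computation, no kernel): with NO finiteness on `X′`/`C` the implication FAILS — over `O = k[t]_(t)` dominated by the rank-1
non-discrete valuation ring `V` of `k(t^(1/p^∞))`, `X′ = Spec V[y,z]/(yz − t)` is integral with reducible special fibre `yz = 0`,
and the blow-up along the NON-finite-type ideal `C = (z) + 𝔪_V` has special fibre `𝔸¹_k` (irreducible): blow-ups of non-Noetherian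
integral schemes along nonzero ideals need not be surjective (`Bl_{𝔪_V} Spec V = Spec Frac V`). The decl is KEPT for the record
(append-only file); its REPAIR is the sibling `SpecialFibreReduciblePersistsLN` below (one more binder `IsLocallyNoetherian X′`,
met by every stage of the ULT/EL♮ closure, which is a blow-up tower of `ℙⁿ_O`). Do not cite this decl as a fact. [folklore] -/
def SpecialFibreReduciblePersists (n : ℕ) : Prop :=
  ∀ (O : Type) [CommRing O] [IsDomain O] [IsDiscreteValuationRing O], (letI := MvPolynomial.gradedAlgebra (σ := Fin (n + 1)) (R := O); ∀ (X' X'' : AlgebraicGeometry.Scheme.{0}) (σ' : X' ⟶ (AlgebraicGeometry.Proj (MvPolynomial.homogeneousSubmodule (Fin (n + 1)) O))) (C : X'.IdealSheafData) (τ : X'' ⟶ X'), AlgebraicGeometry.IsIntegral X' → Literature.AlgebraicGeometry.Resolution.IsBlowup τ C → ¬ IsIrreducible ((CategoryTheory.CategoryStruct.comp σ' (CategoryTheory.CategoryStruct.comp (AlgebraicGeometry.Proj.toSpecZero (MvPolynomial.homogeneousSubmodule (Fin (n + 1)) O)) (AlgebraicGeometry.Spec.map (CommRingCat.ofHom (algebraMap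 O (MvPolynomial.homogeneousSubmodule (Fin (n + 1)) O 0)))))) ⁻¹' {IsLocalRing.closedPoint O}) → ¬ IsIrreducible ((CategoryTheory.CategoryStruct.comp (CategoryTheory.CategoryStruct.comp τ σ') (CategoryTheory.CategoryStruct.comp (AlgebraicGeometry.Proj.toSpecZero (MvPolynomial.homogeneousSubmodule (Fin (n + 1)) O)) (AlgebraicGeometry.Spec.map (CommRingCat.ofHom (algebraMap O (MvPolynomial.homogeneousSubmodule (Fin (n + 1)) O 0)))))) ⁻¹' {IsLocalRing.closedPoint O}))

/-! ## §5 v2 APPEND (2026-08-27): the LOCALLY-NOETHERIAN sibling of lemma V's persistence half — the repair of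
## `SpecialFibreReduciblePersists` (REFUTED-AS-TYPED by hand, res-D-pv-002 05:23:58Z; see its ERRATUM) — and the trivial nesting. -/

/-- [OURS · L1 W4.5(b)] replaces the role of NOTHING in the manuscript; NOT a statement of the manuscript. **LEMMA V, PERSISTENCE HALF,
LOCALLY NOETHERIAN STAGES** (the REPAIR asked by res-D-pv-002 05:23:58Z (B), «the instance the consumers have anyway»): as
`SpecialFibreReduciblePersists n` with ONE more binder `IsLocallyNoetherian X′` right after `IsIntegral X′`. Then a blow-up `τ` of `X′`
along `C ≠ 0` is proper and birational onto the integral `X′`, hence SURJECTIVE, so the special fibre of `X″` maps ONTO that of `X′` and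
irreducibility descends; `C = 0` blows up to `∅`. Proof = res-D-pv-002's kernel-ready `specialFibreReduciblePersistsLN_holds`
(their work/W45bLemmaV.lean a6b44e4f21d59faa), filed by them. VACUITY: hypotheses met by every stage of the EL♮/ULT closure (blow-up
towers over `ℙⁿ_O` are locally Noetherian); still false without `IsIntegral X′`. [folklore] -/
def SpecialFibreReduciblePersistsLN (n : ℕ) : Prop :=
  ∀ (O : Type) [CommRing O] [IsDomain O] [IsDiscreteValuationRing O], (letI := MvPolynomial.gradedAlgebra (σ := Fin (n + 1)) (R := O); ∀ (X' X'' : AlgebraicGeometry.Scheme.{0}) (σ' : X' ⟶ (AlgebraicGeometry.Proj (MvPolynomial.homogeneousSubmodule (Fin (n + 1)) O))) (C : X'.IdealSheafData) (τ : X'' ⟶ X'), AlgebraicGeometry.IsIntegral X' → AlgebraicGeometry.IsLocallyNoetherian X' → Literature.AlgebraicGeometry.Resolution.IsBlowup τ C → ¬ IsIrreducible ((CategoryTheory.CategoryStruct.comp σ' (CategoryTheory.CategoryStruct.comp (AlgebraicGeometry.Proj.toSpecZero (MvPolynomial.homogeneousSubmodule (Fin (n + 1)) O)) (AlgebraicGeometry.Spec.map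 (CommRingCat.ofHom (algebraMap O (MvPolynomial.homogeneousSubmodule (Fin (n + 1)) O 0)))))) ⁻¹' {IsLocalRing.closedPoint O}) → ¬ IsIrreducible ((CategoryTheory.CategoryStruct.comp (CategoryTheory.CategoryStruct.comp τ σ') (CategoryTheory.CategoryStruct.comp (AlgebraicGeometry.Proj.toSpecZero (MvPolynomial.homogeneousSubmodule (Fin (n + 1)) O)) (AlgebraicGeometry.Spec.map (CommRingCat.ofHom (algebraMap O (MvPolynomial.homogeneousSubmodule (Fin (n + 1)) O 0)))))) ⁻¹' {IsLocalRing.closedPoint O}))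

/-- Pure logic: the (refuted) finiteness-free form would imply the locally-Noetherian one (one more hypothesis to discard) — recorded
only to make the direction of repair explicit; its antecedent is NOT available. [folklore] -/
theorem specialFibreReduciblePersistsLN_of_persists {n : ℕ} (h : SpecialFibreReduciblePersists n) :
    SpecialFibreReduciblePersistsLN n := by
  intro O _ _ _ X' X'' σ' C τ hint _ hbl hred
  exact h O X' X'' σ' C τ hint hbl hred

end EquisingularLift

end Summit.ResolutionOfSingularities.ResolutionOfSingularities.Theorems

end
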